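import Summits.QuantumFields.BalabanUV.Beta.GAN24.FineReadoutGradientDecay
import Summits.QuantumFields.BalabanUV.Beta.GAN24.FineReadoutCauchyReal
import Summits.QuantumFields.BalabanUV.Beta.GAN24.TaylorTrilinearLattice
import Summits.QuantumFields.BalabanUV.Beta.GAN24.StencilSlotE3HLeg
import Literature.MathematicalPhysics.QuantumFieldTheory.Balaban1983to89.Beta.OneStepKernelFamily

/-!
# `BalabanUV.Beta.GAN24.FineReadoutCauchyDec` — binder row G-an2-4 / (CONV-C), S-slot, road «S3»: the located leaf «(N1-Cauchy)» of the
# RATE table IN THE FORMS THE DIFF ROWS CONSUME — pointwise samples, weighted averages and the `dec Lc` block-contour mean of the next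
# level's normalised minimiser column against this level's (generic leaf «N1-CAUCHY-DEC*», an ADAPTER; b2b-balaban-gan24-formalise-leaf-19, gen 15)

NOT IN PRINT; OUR PROOF ATTEMPT.  HONEST FRAMING (cell contract, verbatim): «discharging `BetaPertH` makes Bałaban's UV stability
UNCONDITIONAL — a real constructive-QFT result; it is NOT the continuum limit and NOT the Clay problem.»  HONEST DEPENDENCY (verbatim):
«continuum YM on T⁴ ⇐ BetaPertH ∧ nine spine estimates (0/9 proved); BetaPertH ⇐ (D1) ∧ (D4) ∧ CAP+tail; G-an2-4 gates asym, D1 and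
NE2/3/4.»  [folklore] bookkeeping (lattice-path telescoping + finite averaging) over the TREE's (N1′) `FineReadoutGradientDecay.exists_wH_grad_decay`
(generic `d`) and the owner's typed CELL-MEAN statement of «(N1-Cauchy)» (`HOME/b2b-balaban-gan24-p1/N1-CAUCHY-SPEC.md` §1), which enters as a
HYPOTHESIS `hC` (no `def … : Prop`, no cited fact, no wall binder); at `d = 3` `hC` is LITERALLY the conclusion of leaf-13's
`FineReadoutCauchyReal.exists_wH_cellMean_cauchy_three_of_puncturedRate` / of the holder's END `GAN24/FineReadoutCauchy.exists_wH_cellMean_cauchy`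
(leaf-17 lineage) — discharged BY NAME by the consumer the minute that END is a tree theorem.  Discharges NOTHING of «(N1-Cauchy)», of
«E3SupRate»/«E3Shape», of (hS, hSall) by itself; moves no row (ref2 (h)); NOT BetaPertH, NOT continuum, NOT Clay.

## Why (owner SPEC §1, last sentence; leaf-08-g11 NOTE CLAIMS l.5351 (1); typer LEAVES.md v3.3 § III.R input cells of R3-dV/R3-dVt)
The three (N1-Cauchy)-consuming DIFF rows dW/dV/dL compare member `n+3`'s sandwich (legs at blocking `N′ = Lc^{n+3}`) with member `n+2`'s
(blocking `N = Lc^{n+2}`) on ONE lattice: after `DilationCovariance` (tables one scale up = `avgLift Lc` of the tables) and the adjoint of the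
lift, member `n+3`'s normalised minimiser legs `H̃_{N′} = N′^{d+2}·wH_{N′}` enter through their `Lc`-BLOCK-CONTOUR MEANS
`Σ_{i ∈ legSet d Lc a} legW d Lc a · H̃_{N′}(legPt Lc a z i)` (the leg weights of `OneStepKernelFamily.dec`/`InterLevelTransport.avgLift` — the
contour multiplicities, exactly), or through samples `H̃_{N′}(Lc•z + v)` at bounded fine offsets `v`.  The owner's «(N1-Cauchy)» is typed for the
plain CELL MEAN `Lc^{−(d+1)}·Σ_{r ∈ box Lc} H̃_{N′}(Lc•z + r)`.  The passage is (N1′): the unit gradient of `H̃_{N′}` is `O(N′⁻¹)` with block decay,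
so every sample in a bounded fine neighbourhood of the cell differs from the cell mean by `O(Lc/N′) = O(Lc^{−(n+1)})` — geometric in the member.

## What is proved (generic `d`; `Lc ≥ 1` for the algebra, `Lc ≥ 2` for the packaged rate `θ′ = max θ Lc⁻¹ < 1`)
* §1 (abstract, one level pair `N′ = N·Lc`, any real function `F` with unit forward differences `≤ G·e^{−δ|quo_{N′} w − p|₁}` and a number `f`
  within `ε` of `F`'s `Lc`-cell mean over `Lc•z + box`): `abs_sample_sub_le` (`|F(Lc•z + v) − f| ≤ ε + R·G·e^{δR}·e^{−δ|quo_N z − p|₁}`,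
  `R ≥ |v|₁ + (d+1)·Lc`), `abs_wavg_sub_le` (finite weighted averages of such samples, weights `≥ 0` summing to `1`), `abs_dec_sub_le`
  (the `dec Lc` block-contour mean of ANY leg type `a : Fib d`, `R = 3(d+1)·Lc`, via `OneStepKernelFamily.l1_legPt_sub_le` + `sum_legW`).
* §2 (the column, one member `n`, explicit constants): `grad_bound_wH` ((N1′) ⟹ §1's gradient hypothesis for `H̃_{Lc^(n+2)}` with
  `G = C′·(Lc^(n+2))⁻¹`, `δ = κ₀/(d+1)`, `p = 0`), `abs_sample_sub_le_wH`, `abs_dec_sub_le_wH`.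
* PART 2 = `GAN24/FineReadoutCauchyDecLegs` (all members, existential packaging from the cell-MEAN hypothesis `hC` + the TREE's (N1′);
  the `d = 3` leg differences in `StencilSlotE3HLeg.legs_three` currency).
Unit `b2b-balaban-gan24-formalise-leaf-19` (gen 15), 2026-08-20.
-/

noncomputable section

open Finset
open scoped BigOperators
open Literature.MathematicalPhysics.QuantumFieldTheory
open Literature.MathematicalPhysics.QuantumFieldTheory.Balaban1983to89
open Literature.MathematicalPhysics.QuantumFieldTheory.Balaban1983to89.Beta
open Literature.MathematicalPhysics.QuantumFieldTheory.LatticeForm (quo)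
open B12Sec2to5 (l1 l1_nonneg)
open B4ContourShift (supNorm supNorm_nonneg)
open ExpKernelCalculus (l1_sub_triangle l1_sub_symm)
open AffineAveraging (box toSite)
open KernelSpecInstance (wH)
open KKTFluctuationKernel (GamΦ)
open ResolventComposition (GamΦ_eq_neg_wH)
open T4GaugeActionRatePair (exp_sup_le_exp_l1)
open OneStepResolventKernel (Fib)
open OneStepKernelFamily (legSet legPt legW sum_legW legW_nonneg l1_legPt_sub_le legPt_add)
open Summit.QuantumFields.BalabanUV.Beta.GAN24.CombesThomasFibre (quo_sub_zsmul)
open Summit.QuantumFields.BalabanUV.Beta.GAN24.FineReadoutCauchyFrame (quo_cell toSite_mem_range)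
open Summit.QuantumFields.BalabanUV.Beta.GAN24.FineReadoutCauchyReal (card_box_eq)
open Summit.QuantumFields.BalabanUV.Beta.GAN24.TaylorTrilinearLattice (abs_sub_le_of_unit_steps)
open Summit.QuantumFields.BalabanUV.Beta.GAN24.FineReadoutGradientDecay (exists_wH_grad_decay exp_neg_mul_le_of_le)

namespace Summit.QuantumFields.BalabanUV.Beta.GAN24.FineReadoutCauchyDec

variable {d : ℕ}

/-! ## §1 Abstract: a sample (or an average of samples) near a cell against the cell mean -/

section Abstract

/-- [folklore] A cell offset has `ℓ¹` size at most `(d+1)·Lc`. -/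
theorem l1_toSite_le {Lc : ℕ} {r : Fin (d + 1) → ℕ} (hr : r ∈ box (d + 1) Lc) : l1 (toSite r) ≤ (d + 1) * Lc := by
  unfold l1
  calc ∑ i : Fin (d + 1), |((toSite r i : ℤ) : ℝ)| ≤ ∑ _i : Fin (d + 1), (Lc : ℝ) := by
        refine Finset.sum_le_sum fun i _ => ?_
        obtain ⟨h0, hlt⟩ := toSite_mem_range hr i
        rw [abs_of_nonneg (by exact_mod_cast h0)]
        exact_mod_cast hlt.le
    _ = (d + 1) * Lc := by
        rw [Finset.sum_const, Finset.card_univ, Fintype.card_fin, nsmul_eq_mul]; push_cast; ring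

/-- [folklore] `|v − w|₁ ≤ |v|₁ + |w|₁`. -/
theorem l1_sub_le (v w : Fin (d + 1) → ℤ) : l1 (v - w) ≤ l1 v + l1 w := by
  have h := l1_sub_triangle v 0 w
  rwa [sub_zero, zero_sub, show l1 (-w) = l1 w by
    have := l1_sub_symm 0 w; rwa [zero_sub, sub_zero] at this] at h

/-- [folklore] The step weight `s·G·e^{δs}` is monotone in `s ≥ 0`. -/
theorem step_weight_mono {G δ s R : ℝ} (hG : 0 ≤ G) (hδ : 0 ≤ δ) (hs : 0 ≤ s) (hsR : s ≤ R) :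
    s * G * Real.exp (δ * s) ≤ R * G * Real.exp (δ * R) := by
  have h1 : Real.exp (δ * s) ≤ Real.exp (δ * R) := Real.exp_le_exp.2 (by nlinarith)
  calc s * G * Real.exp (δ * s) ≤ s * G * Real.exp (δ * R) :=
        mul_le_mul_of_nonneg_left h1 (mul_nonneg hs hG)
    _ ≤ R * G * Real.exp (δ * R) := by
        have := Real.exp_pos (δ * R)
        gcongr

variable {N N' Lc : ℕ} [NeZero N'] [NeZero Lc]

/-- [folklore] **A SAMPLE NEAR THE CELL AGAINST THE CELL MEAN'S TARGET.**  Let `N′ = N·Lc`.  If the unit forward differences of `F` are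
bounded by `G·e^{−δ|quo_{N′} w − p|₁}` (every fine site `w`, every direction) and the `Lc`-cell mean of `F` over the cell `Lc•z + box`
is within `ε` of the number `f`, then EVERY sample `F(Lc•z + v)` with `|v|₁ + (d+1)·Lc ≤ R` is within
`ε + R·G·e^{δR}·e^{−δ|quo_N z − p|₁}` of `f` (each cell point `Lc•z + r` has block label `quo_N z`, `FineReadoutCauchyFrame.quo_cell`; one lattice
path from it to `Lc•z + v`, `TaylorTrilinearLattice.abs_sub_le_of_unit_steps`). -/
theorem abs_sample_sub_le (hN : N' = N * Lc) {F : (Fin (d + 1) → ℤ) → ℝ} {f G δ ε R : ℝ} {p : Fin (d + 1) → ℤ}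
    (hG : 0 ≤ G) (hδ : 0 ≤ δ)
    (hF : ∀ w ν, |F (w + Pi.single ν 1) - F w| ≤ G * Real.exp (-δ * l1 (quo N' w - p)))
    (z : Fin (d + 1) → ℤ)
    (hm : |((Lc : ℝ) ^ (d + 1))⁻¹ * ∑ r ∈ box (d + 1) Lc, F ((Lc : ℤ) • z + toSite r) - f| ≤ ε)
    {v : Fin (d + 1) → ℤ} (hv : l1 v + (d + 1) * Lc ≤ R) :
    |F ((Lc : ℤ) • z + v) - f| ≤ ε + R * G * Real.exp (δ * R) * Real.exp (-δ * l1 (quo N z - p)) := by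
  set cL : ℝ := (Lc : ℝ) ^ (d + 1) with hcL
  have hcLpos : 0 < cL := by
    have : (0 : ℝ) < Lc := by exact_mod_cast Nat.pos_of_ne_zero (NeZero.ne Lc)
    positivity
  set W : ℝ := Real.exp (-δ * l1 (quo N z - p)) with hW
  set K : ℝ := R * G * Real.exp (δ * R) * W with hK
  -- each cell point against the sample
  have hcell : ∀ r ∈ box (d + 1) Lc, |F ((Lc : ℤ) • z + v) - F ((Lc : ℤ) • z + toSite r)| ≤ K := by
    intro r hr
    have h := abs_sub_le_of_unit_steps N' hG hδ hF ((Lc : ℤ) • z + toSite r) (v - toSite r)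
    rw [show (Lc : ℤ) • z + toSite r + (v - toSite r) = (Lc : ℤ) • z + v by abel, quo_cell hN z hr] at h
    have hs : l1 (v - toSite r) ≤ R := by
      have h1 := l1_sub_le v (toSite r)
      have h2 := l1_toSite_le (d := d) hr
      linarith
    have hstep := step_weight_mono hG hδ (l1_nonneg _) hs
    calc |F ((Lc : ℤ) • z + v) - F ((Lc : ℤ) • z + toSite r)|
        ≤ l1 (v - toSite r) * G * Real.exp (δ * l1 (v - toSite r)) * W := h
      _ ≤ R * G * Real.exp (δ * R) * W := mul_le_mul_of_nonneg_right hstep (Real.exp_pos _).le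
  -- the sample against the cell mean
  have hmean : |F ((Lc : ℤ) • z + v) - cL⁻¹ * ∑ r ∈ box (d + 1) Lc, F ((Lc : ℤ) • z + toSite r)| ≤ K := by
    have e : F ((Lc : ℤ) • z + v) - cL⁻¹ * ∑ r ∈ box (d + 1) Lc, F ((Lc : ℤ) • z + toSite r) =
        cL⁻¹ * ∑ r ∈ box (d + 1) Lc, (F ((Lc : ℤ) • z + v) - F ((Lc : ℤ) • z + toSite r)) := by
      rw [Finset.sum_sub_distrib, Finset.sum_const, nsmul_eq_mul, mul_sub, ← mul_assoc]
      rw [show ((box (d + 1) Lc).card : ℝ) = cL from card_box_eq Lc, inv_mul_cancel₀ hcLpos.ne', one_mul]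
    rw [e, abs_mul, abs_inv, abs_of_pos hcLpos]
    calc cL⁻¹ * |∑ r ∈ box (d + 1) Lc, (F ((Lc : ℤ) • z + v) - F ((Lc : ℤ) • z + toSite r))|
        ≤ cL⁻¹ * ∑ r ∈ box (d + 1) Lc, |F ((Lc : ℤ) • z + v) - F ((Lc : ℤ) • z + toSite r)| :=
          mul_le_mul_of_nonneg_left (Finset.abs_sum_le_sum_abs _ _) (inv_nonneg.2 hcLpos.le)
      _ ≤ cL⁻¹ * ∑ _r ∈ box (d + 1) Lc, K := mul_le_mul_of_nonneg_left (Finset.sum_le_sum hcell) (inv_nonneg.2 hcLpos.le)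
      _ = K := by
          rw [Finset.sum_const, nsmul_eq_mul, show ((box (d + 1) Lc).card : ℝ) = cL from card_box_eq Lc, ← mul_assoc,
            inv_mul_cancel₀ hcLpos.ne', one_mul]
  calc |F ((Lc : ℤ) • z + v) - f|
      = |(F ((Lc : ℤ) • z + v) - cL⁻¹ * ∑ r ∈ box (d + 1) Lc, F ((Lc : ℤ) • z + toSite r)) +
          (cL⁻¹ * ∑ r ∈ box (d + 1) Lc, F ((Lc : ℤ) • z + toSite r) - f)| := by ring_nf
    _ ≤ K + ε := (abs_add_le _ _).trans (add_le_add hmean hm)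
    _ = ε + R * G * Real.exp (δ * R) * Real.exp (-δ * l1 (quo N z - p)) := by rw [hK, add_comm]

/-- [folklore] **A WEIGHTED AVERAGE OF SAMPLES NEAR THE CELL** (weights `≥ 0` summing to `1`, offsets `|v i|₁ + (d+1)·Lc ≤ R`): the same bound
(the shifted cell means `Lc•z + t•e_κ + box`, the straight-contour means, the block-contour means are all instances). -/
theorem abs_wavg_sub_le (hN : N' = N * Lc) {F : (Fin (d + 1) → ℤ) → ℝ} {f G δ ε R : ℝ} {p : Fin (d + 1) → ℤ}
    (hG : 0 ≤ G) (hδ : 0 ≤ δ)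
    (hF : ∀ w ν, |F (w + Pi.single ν 1) - F w| ≤ G * Real.exp (-δ * l1 (quo N' w - p)))
    (z : Fin (d + 1) → ℤ)
    (hm : |((Lc : ℝ) ^ (d + 1))⁻¹ * ∑ r ∈ box (d + 1) Lc, F ((Lc : ℤ) • z + toSite r) - f| ≤ ε)
    {ι : Type*} (S : Finset ι) {w : ι → ℝ} {v : ι → (Fin (d + 1) → ℤ)} (hw0 : ∀ i ∈ S, 0 ≤ w i)
    (hw1 : ∑ i ∈ S, w i = 1) (hv : ∀ i ∈ S, l1 (v i) + (d + 1) * Lc ≤ R) :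
    |∑ i ∈ S, w i * F ((Lc : ℤ) • z + v i) - f| ≤ ε + R * G * Real.exp (δ * R) * Real.exp (-δ * l1 (quo N z - p)) := by
  set K : ℝ := ε + R * G * Real.exp (δ * R) * Real.exp (-δ * l1 (quo N z - p)) with hK
  have e : ∑ i ∈ S, w i * F ((Lc : ℤ) • z + v i) - f = ∑ i ∈ S, w i * (F ((Lc : ℤ) • z + v i) - f) := by
    simp only [mul_sub, Finset.sum_sub_distrib, ← Finset.sum_mul, hw1, one_mul]
  rw [e]
  calc |∑ i ∈ S, w i * (F ((Lc : ℤ) • z + v i) - f)| ≤ ∑ i ∈ S, |w i * (F ((Lc : ℤ) • z + v i) - f)| :=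
        Finset.abs_sum_le_sum_abs _ _
    _ ≤ ∑ i ∈ S, w i * K := by
        refine Finset.sum_le_sum fun i hi => ?_
        rw [abs_mul, abs_of_nonneg (hw0 i hi)]
        exact mul_le_mul_of_nonneg_left (abs_sample_sub_le hN hG hδ hF z hm (hv i hi)) (hw0 i hi)
    _ = K := by rw [← Finset.sum_mul, hw1, one_mul]

/-- [folklore] **THE `dec Lc` BLOCK-CONTOUR MEAN NEAR THE CELL** (any leg type `a : Fib d`; the leg weights `legW` are `≥ 0` and sum to `1`,
`OneStepKernelFamily.sum_legW`, and every leg point lies within `ℓ¹`-distance `2(d+1)·Lc` of `Lc•z`, `l1_legPt_sub_le`): the bound with `R = 3(d+1)·Lc`. -/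
theorem abs_dec_sub_le (hN : N' = N * Lc) {F : (Fin (d + 1) → ℤ) → ℝ} {f G δ ε : ℝ} {p : Fin (d + 1) → ℤ}
    (hG : 0 ≤ G) (hδ : 0 ≤ δ)
    (hF : ∀ w ν, |F (w + Pi.single ν 1) - F w| ≤ G * Real.exp (-δ * l1 (quo N' w - p)))
    (z : Fin (d + 1) → ℤ)
    (hm : |((Lc : ℝ) ^ (d + 1))⁻¹ * ∑ r ∈ box (d + 1) Lc, F ((Lc : ℤ) • z + toSite r) - f| ≤ ε) (a : Fib d) :
    |∑ i ∈ legSet d Lc a, legW d Lc a * F (legPt Lc a z i) - f| ≤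
      ε + (3 * (d + 1) * Lc) * G * Real.exp (δ * (3 * (d + 1) * Lc)) * Real.exp (-δ * l1 (quo N z - p)) := by
  have hoff : ∀ i, legPt Lc a z i = (Lc : ℤ) • z + legPt Lc a 0 i := by
    intro i
    have h := legPt_add Lc a 0 z i
    rw [zero_add] at h
    rw [h]; exact add_comm _ _
  simp only [hoff]
  refine abs_wavg_sub_le hN hG hδ hF z hm (legSet d Lc a) (fun i _ => legW_nonneg Lc a) (sum_legW (NeZero.ne Lc) a)
    (fun i hi => ?_)
  have h := l1_legPt_sub_le Lc a 0 hi
  rw [smul_zero, sub_zero] at h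
  have hd : (0 : ℝ) ≤ (d + 1) * Lc := by positivity
  linarith

end Abstract

/-! ## §2 The normalised minimiser column of member `n+2` against member `n+1`'s (one member, explicit constants) -/

section Column

variable {Lc : ℕ} [NeZero Lc]

omit [NeZero Lc] in
/-- [folklore] `Lc^(n+2) = Lc^(n+1)·Lc`. -/
theorem pow_succ_succ_eq (n : ℕ) : Lc ^ (n + 2) = Lc ^ (n + 1) * Lc := pow_succ Lc (n + 1)

/-- [folklore] **(N1′) ⟹ THE GRADIENT HYPOTHESIS OF §1** for the normalised column `H̃_{N′} = N′^{d+2}·wH_{N′}`, `N′ = Lc^(n+2)`: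
`|H̃_{N′}(w + e_ν) − H̃_{N′}(w)| ≤ C′·(Lc^(n+2))⁻¹ · e^{−(κ₀/(d+1))·|quo_{N′} w − 0|₁}` (sup-norm block decay weakened to block-ℓ¹,
`T4GaugeActionRatePair.exp_sup_le_exp_l1`). -/
theorem grad_bound_wH {κ₀ C' : ℝ} (hκ₀ : 0 ≤ κ₀) (hC' : 0 ≤ C')
    (hN1' : ∀ (j : ℕ) (κ l : Fin (d + 1)) (z : Fin (d + 1) → ℤ) (ν : Fin (d + 1)),
      |wH (N := Lc ^ (j + 1)) κ l (z + Pi.single ν 1) - wH (N := Lc ^ (j + 1)) κ l z|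
        ≤ C' * (((Lc ^ (j + 1) : ℕ) : ℝ) ^ (d + 3))⁻¹ * Real.exp (-(κ₀ * supNorm (quo (Lc ^ (j + 1)) z))))
    (n : ℕ) (κ l : Fin (d + 1)) (w : Fin (d + 1) → ℤ) (ν : Fin (d + 1)) :
    |((Lc : ℝ) ^ (n + 2)) ^ (d + 2) * wH (N := Lc ^ (n + 2)) κ l (w + Pi.single ν 1) -
        ((Lc : ℝ) ^ (n + 2)) ^ (d + 2) * wH (N := Lc ^ (n + 2)) κ l w|
      ≤ (C' * ((Lc : ℝ) ^ (n + 2))⁻¹) * Real.exp (-(κ₀ / ((d : ℝ) + 1)) * l1 (quo (Lc ^ (n + 2)) w - 0)) := by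
  have hL : (0 : ℝ) < (Lc : ℝ) ^ (n + 2) := by
    have : (0 : ℝ) < Lc := by exact_mod_cast Nat.pos_of_ne_zero (NeZero.ne Lc)
    positivity
  set P : ℝ := ((Lc : ℝ) ^ (n + 2)) ^ (d + 2) with hP
  have hP0 : 0 ≤ P := by positivity
  have h := hN1' (n + 1) κ l w ν
  rw [show n + 1 + 1 = n + 2 from rfl] at h
  have hcast : (((Lc ^ (n + 2) : ℕ) : ℝ)) = (Lc : ℝ) ^ (n + 2) := by push_cast; rfl
  rw [hcast] at h
  have hkey : P * (((Lc : ℝ) ^ (n + 2)) ^ (d + 3))⁻¹ = ((Lc : ℝ) ^ (n + 2))⁻¹ := by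
    rw [hP, pow_succ ((Lc : ℝ) ^ (n + 2)) (d + 2), mul_inv, ← mul_assoc, mul_inv_cancel₀ (pow_ne_zero _ hL.ne'), one_mul]
  have hexp := exp_sup_le_exp_l1 (d := d) hκ₀ (quo (Lc ^ (n + 2)) w)
  rw [sub_zero, ← mul_sub, abs_mul, abs_of_nonneg hP0]
  calc P * |wH (N := Lc ^ (n + 2)) κ l (w + Pi.single ν 1) - wH (N := Lc ^ (n + 2)) κ l w|
      ≤ P * (C' * (((Lc : ℝ) ^ (n + 2)) ^ (d + 3))⁻¹ * Real.exp (-(κ₀ * supNorm (quo (Lc ^ (n + 2)) w)))) :=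
        mul_le_mul_of_nonneg_left h hP0
    _ = C' * (P * (((Lc : ℝ) ^ (n + 2)) ^ (d + 3))⁻¹) * Real.exp (-(κ₀ * supNorm (quo (Lc ^ (n + 2)) w))) := by ring
    _ = C' * ((Lc : ℝ) ^ (n + 2))⁻¹ * Real.exp (-(κ₀ * supNorm (quo (Lc ^ (n + 2)) w))) := by rw [hkey]
    _ ≤ C' * ((Lc : ℝ) ^ (n + 2))⁻¹ * Real.exp (-(κ₀ / ((d : ℝ) + 1)) * l1 (quo (Lc ^ (n + 2)) w)) :=
        mul_le_mul_of_nonneg_left hexp (by positivity)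

/-- [folklore] **ONE MEMBER, A SAMPLE**: if the cell-mean difference of «(N1-Cauchy)» at `(n, κ, l, z)` is `≤ ε` and (N1′) holds with `(κ₀, C′)`,
then for every fine offset `v` with `|v|₁ + (d+1)·Lc ≤ R`,
`|H̃_{Lc^(n+2)}(Lc•z + v) − H̃_{Lc^(n+1)}(z)| ≤ ε + R·C′·(Lc^(n+2))⁻¹·e^{(κ₀/(d+1))R}·e^{−(κ₀/(d+1))|quo_{Lc^(n+1)} z|₁}`. -/
theorem abs_sample_sub_le_wH {κ₀ C' : ℝ} (hκ₀ : 0 ≤ κ₀) (hC' : 0 ≤ C')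
    (hN1' : ∀ (j : ℕ) (κ l : Fin (d + 1)) (z : Fin (d + 1) → ℤ) (ν : Fin (d + 1)),
      |wH (N := Lc ^ (j + 1)) κ l (z + Pi.single ν 1) - wH (N := Lc ^ (j + 1)) κ l z|
        ≤ C' * (((Lc ^ (j + 1) : ℕ) : ℝ) ^ (d + 3))⁻¹ * Real.exp (-(κ₀ * supNorm (quo (Lc ^ (j + 1)) z))))
    (n : ℕ) (κ l : Fin (d + 1)) (z : Fin (d + 1) → ℤ) {ε : ℝ}
    (hm : |((Lc : ℝ) ^ (d + 1))⁻¹ * ∑ r ∈ box (d + 1) Lc,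
        ((Lc : ℝ) ^ (n + 2)) ^ (d + 2) * wH (N := Lc ^ (n + 2)) κ l ((Lc : ℤ) • z + toSite r) -
          ((Lc : ℝ) ^ (n + 1)) ^ (d + 2) * wH (N := Lc ^ (n + 1)) κ l z| ≤ ε)
    {R : ℝ} {v : Fin (d + 1) → ℤ} (hv : l1 v + (d + 1) * Lc ≤ R) :
    |((Lc : ℝ) ^ (n + 2)) ^ (d + 2) * wH (N := Lc ^ (n + 2)) κ l ((Lc : ℤ) • z + v) -
        ((Lc : ℝ) ^ (n + 1)) ^ (d + 2) * wH (N := Lc ^ (n + 1)) κ l z|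
      ≤ ε + R * (C' * ((Lc : ℝ) ^ (n + 2))⁻¹) * Real.exp (κ₀ / ((d : ℝ) + 1) * R) *
          Real.exp (-(κ₀ / ((d : ℝ) + 1)) * l1 (quo (Lc ^ (n + 1)) z)) := by
  have hL : (0 : ℝ) < (Lc : ℝ) ^ (n + 2) := by
    have : (0 : ℝ) < Lc := by exact_mod_cast Nat.pos_of_ne_zero (NeZero.ne Lc)
    positivity
  have h := abs_sample_sub_le (d := d) (N := Lc ^ (n + 1)) (N' := Lc ^ (n + 2)) (Lc := Lc) (pow_succ_succ_eq n)
    (F := fun w => ((Lc : ℝ) ^ (n + 2)) ^ (d + 2) * wH (N := Lc ^ (n + 2)) κ l w)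
    (f := ((Lc : ℝ) ^ (n + 1)) ^ (d + 2) * wH (N := Lc ^ (n + 1)) κ l z) (p := 0)
    (by positivity) (by positivity) (grad_bound_wH hκ₀ hC' hN1' n κ l) z hm hv
  rwa [sub_zero] at h

/-- [folklore] **ONE MEMBER, THE `dec Lc` BLOCK-CONTOUR MEAN** (any leg type `a`; `R = 3(d+1)·Lc`). -/
theorem abs_dec_sub_le_wH {κ₀ C' : ℝ} (hκ₀ : 0 ≤ κ₀) (hC' : 0 ≤ C')
    (hN1' : ∀ (j : ℕ) (κ l : Fin (d + 1)) (z : Fin (d + 1) → ℤ) (ν : Fin (d + 1)),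
      |wH (N := Lc ^ (j + 1)) κ l (z + Pi.single ν 1) - wH (N := Lc ^ (j + 1)) κ l z|
        ≤ C' * (((Lc ^ (j + 1) : ℕ) : ℝ) ^ (d + 3))⁻¹ * Real.exp (-(κ₀ * supNorm (quo (Lc ^ (j + 1)) z))))
    (n : ℕ) (κ l : Fin (d + 1)) (z : Fin (d + 1) → ℤ) {ε : ℝ}
    (hm : |((Lc : ℝ) ^ (d + 1))⁻¹ * ∑ r ∈ box (d + 1) Lc,
        ((Lc : ℝ) ^ (n + 2)) ^ (d + 2) * wH (N := Lc ^ (n + 2)) κ l ((Lc : ℤ) • z + toSite r) -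
          ((Lc : ℝ) ^ (n + 1)) ^ (d + 2) * wH (N := Lc ^ (n + 1)) κ l z| ≤ ε) (a : Fib d) :
    |∑ i ∈ legSet d Lc a, legW d Lc a * (((Lc : ℝ) ^ (n + 2)) ^ (d + 2) * wH (N := Lc ^ (n + 2)) κ l (legPt Lc a z i)) -
        ((Lc : ℝ) ^ (n + 1)) ^ (d + 2) * wH (N := Lc ^ (n + 1)) κ l z|
      ≤ ε + (3 * (d + 1) * Lc) * (C' * ((Lc : ℝ) ^ (n + 2))⁻¹) * Real.exp (κ₀ / ((d : ℝ) + 1) * (3 * (d + 1) * Lc)) *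
          Real.exp (-(κ₀ / ((d : ℝ) + 1)) * l1 (quo (Lc ^ (n + 1)) z)) := by
  have h := abs_dec_sub_le (d := d) (N := Lc ^ (n + 1)) (N' := Lc ^ (n + 2)) (Lc := Lc) (pow_succ_succ_eq n)
    (F := fun w => ((Lc : ℝ) ^ (n + 2)) ^ (d + 2) * wH (N := Lc ^ (n + 2)) κ l w)
    (f := ((Lc : ℝ) ^ (n + 1)) ^ (d + 2) * wH (N := Lc ^ (n + 1)) κ l z) (p := 0)
    (by positivity) (by positivity) (grad_bound_wH hκ₀ hC' hN1' n κ l) z hm a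
  rwa [sub_zero] at h

end Column

end Summit.QuantumFields.BalabanUV.Beta.GAN24.FineReadoutCauchyDec

end
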